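import Summits.ValiantsHypothesis.ValiantsHypothesis.Theorems.KPlusLogSqLawTropicalBMarkedEdgeFourBitLaw

/-!
# Route «KPlusLogSqLaw», crux `TropicalB` (stmt-ValiantsHypothesis-19771) — MARKED-EDGE sector, FOUR-BIT LAW, part 6:
# COMPLEMENTATION (companion nodes) — transport lemmas

HONEST FRAMING.  Helper file (cell `pub-symmetroid`, seat val-sym-trop-p4 (g16), 2026-08-28; `--supports stmt-ValiantsHypothesis-19771
--as helper`).  Kernel version of the COMPLEMENTATION SYMMETRY of the marked-edge sector (g15 THEOREM-FOURBIT.md §5 Proposition): adding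
one loop-less COMPANION node `l̄` per marked node `b l`, redirecting the arcs into / out of `b l` through `l̄`, trading the marked loop for
the 2-cycle `b l ↔ l̄` and giving `b l` a fresh marked loop, turns every cover into a cover of the enlarged node set `V ⊕ Fin 4` that uses
the NEW marked loop at `b l` iff the old cover did NOT use the old one; weights are preserved and slopes reflected.  This file proves the
transport facts in the abstract cover setting of parts 3–4, for maps CHARACTERISED BY EQUATIONS (no definition is introduced; part 7
instantiates them): the redirect map `t : V → V ⊕ Fin 4` (`t (b k) = inr k`, `t j = inl j` otherwise), the cover map `Fd σ`, and the
new presence / weight / slope data `okC / wC / gC`.  Nothing here concerns general designs, `TropicalB` in its window, `WeakLifting`, the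
doors, `MatrixDescartes` (stmt-ValiantsHypothesis-18050) or VP ≠ VNP.
-/

set_option linter.dupNamespace false
set_option autoImplicit false

namespace Summit.ValiantsHypothesis.ValiantsHypothesis.Theorems.KPlusLogSqLaw
namespace MarkedEdge
namespace FourBit

open Finset

variable {V : Type*} [Fintype V] [DecidableEq V]

section Redirect

variable {b : Fin 4 → V} (hb : Function.Injective b) {t : V → V ⊕ Fin 4}
  (ht1 : ∀ k, t (b k) = Sum.inr k) (ht2 : ∀ j, (∀ k, b k ≠ j) → t j = Sum.inl j)
include hb ht1 ht2

omit [Fintype V] hb in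
/-- The redirect map hits an old node only at an unmarked argument, which it keeps. [this seat's lemma] -/
theorem t_eq_inl_iff (j i : V) : t j = Sum.inl i ↔ (j = i ∧ ∀ k, b k ≠ i) := by
  constructor
  · intro h
    by_cases hm : ∃ k, b k = j
    · obtain ⟨k, rfl⟩ := hm
      rw [ht1] at h; exact absurd h (by simp)
    · push Not at hm
      rw [ht2 j hm] at h
      have hji : j = i := Sum.inl.inj h
      subst hji
      exact ⟨rfl, hm⟩
  · rintro ⟨rfl, hm⟩
    exact ht2 j hm

omit [Fintype V] hb in
/-- The redirect map hits the companion `k` exactly at the marked node `b k`. [this seat's lemma] -/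
theorem t_eq_inr_iff (j : V) (k : Fin 4) : t j = Sum.inr k ↔ j = b k := by
  constructor
  · intro h
    by_cases hm : ∃ k', b k' = j
    · obtain ⟨k', rfl⟩ := hm
      rw [ht1] at h
      rw [Sum.inr.inj h]
    · push Not at hm
      rw [ht2 j hm] at h; exact absurd h (by simp)
  · rintro rfl; exact ht1 k

omit [Fintype V] hb in
/-- The redirect map is injective. [this seat's lemma] -/
theorem t_injective : Function.Injective t := by
  intro j j' h
  rcases hv : t j' with i | k
  · rw [hv] at h
    exact ((t_eq_inl_iff ht1 ht2 j i).mp h).1.trans ((t_eq_inl_iff ht1 ht2 j' i).mp hv).1.symm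
  · rw [hv] at h
    exact ((t_eq_inr_iff ht1 ht2 j k).mp h).trans ((t_eq_inr_iff ht1 ht2 j' k).mp hv).symm

variable {Fd : Equiv.Perm V → V ⊕ Fin 4 → V ⊕ Fin 4}
  (hF1 : ∀ (σ : Equiv.Perm V) (i : V), (∀ k, b k ≠ i) → Fd σ (Sum.inl i) = t (σ i))
  (hF2 : ∀ (σ : Equiv.Perm V) (l : Fin 4), σ (b l) = b l → Fd σ (Sum.inl (b l)) = Sum.inr l)
  (hF3 : ∀ (σ : Equiv.Perm V) (l : Fin 4), σ (b l) ≠ b l → Fd σ (Sum.inl (b l)) = Sum.inl (b l))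
  (hF4 : ∀ (σ : Equiv.Perm V) (l : Fin 4), σ (b l) = b l → Fd σ (Sum.inr l) = Sum.inl (b l))
  (hF5 : ∀ (σ : Equiv.Perm V) (l : Fin 4), σ (b l) ≠ b l → Fd σ (Sum.inr l) = t (σ (b l)))
include hF1 hF2 hF3 hF4 hF5

omit [Fintype V] in
/-- **The complemented cover is a permutation** (injective on the finite node set `V ⊕ Fin 4`). [this seat's lemma; THEOREM-FOURBIT.md
§5] -/
theorem Fd_injective (σ : Equiv.Perm V) : Function.Injective (Fd σ) := by
  have tinl := t_eq_inl_iff ht1 ht2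
  have tinr := t_eq_inr_iff ht1 ht2
  have tinj := t_injective ht1 ht2
  -- value of `Fd σ` at an old node, by cases
  have vinl : ∀ i, (Fd σ (Sum.inl i) = t (σ i) ∧ ((∀ k, b k ≠ i) ∨ σ i = i)) ∨
      (∃ l, b l = i ∧ σ i ≠ i ∧ Fd σ (Sum.inl i) = Sum.inl i) := by
    intro i
    by_cases hm : ∃ l, b l = i
    · obtain ⟨l, rfl⟩ := hm
      by_cases hfix : σ (b l) = b l
      · left; refine ⟨?_, Or.inr hfix⟩; rw [hF2 σ l hfix, ← ht1 l, hfix]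
      · right; exact ⟨l, rfl, hfix, hF3 σ l hfix⟩
    · push Not at hm
      left; exact ⟨hF1 σ i hm, Or.inl hm⟩
  have vinr : ∀ l, (σ (b l) = b l ∧ Fd σ (Sum.inr l) = Sum.inl (b l)) ∨ (σ (b l) ≠ b l ∧ Fd σ (Sum.inr l) = t (σ (b l))) := by
    intro l
    by_cases hfix : σ (b l) = b l
    · exact Or.inl ⟨hfix, hF4 σ l hfix⟩
    · exact Or.inr ⟨hfix, hF5 σ l hfix⟩
  intro u u' huu
  rcases u with i | l <;> rcases u' with i' | l'
  · -- old / old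
    rcases vinl i with ⟨hv, _⟩ | ⟨l, hl, hne, hv⟩ <;> rcases vinl i' with ⟨hv', _⟩ | ⟨l', hl', hne', hv'⟩
    · rw [hv, hv'] at huu; exact congrArg Sum.inl (σ.injective (tinj huu))
    · rw [hv, hv'] at huu
      obtain ⟨-, hm⟩ := (tinl _ _).mp huu
      exact absurd hl' (hm l')
    · rw [hv, hv'] at huu
      obtain ⟨-, hm⟩ := (tinl _ _).mp huu.symm
      exact absurd hl (hm l)
    · rw [hv, hv'] at huu; exact huu
  · -- old / companion
    exfalso
    rcases vinl i with ⟨hv, hor⟩ | ⟨l, hl, hne, hv⟩ <;> rcases vinr l' with ⟨hfix', hv'⟩ | ⟨hne', hv'⟩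
    · rw [hv, hv'] at huu
      obtain ⟨h1, hm⟩ := (tinl _ _).mp huu
      exact hm l' rfl
    · rw [hv, hv'] at huu
      have h1 := σ.injective (tinj huu)
      subst h1
      rcases hor with hm | hfix
      · exact hm l' rfl
      · exact hne' hfix
    · rw [hv, hv'] at huu
      have h1 : i = b l' := Sum.inl.inj huu
      rw [h1] at hne; exact hne hfix'
    · rw [hv, hv'] at huu
      obtain ⟨-, hm⟩ := (tinl _ _).mp huu.symm
      exact hm l hl
  · -- companion / old
    exfalso
    rcases vinl i' with ⟨hv', hor⟩ | ⟨l', hl', hne', hv'⟩ <;> rcases vinr l with ⟨hfix, hv⟩ | ⟨hne, hv⟩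
    · rw [hv, hv'] at huu
      obtain ⟨h1, hm⟩ := (tinl _ _).mp huu.symm
      exact hm l rfl
    · rw [hv, hv'] at huu
      have h1 := σ.injective (tinj huu)
      rcases hor with hm | hfix
      · exact hm l h1
      · exact hne (by rw [h1]; exact hfix)
    · rw [hv, hv'] at huu
      have h1 : b l = i' := Sum.inl.inj huu
      rw [← h1] at hne'; exact hne' hfix
    · rw [hv, hv'] at huu
      obtain ⟨-, hm⟩ := (tinl _ _).mp huu
      exact hm l' hl'
  · -- companion / companion
    rcases vinr l with ⟨hfix, hv⟩ | ⟨hne, hv⟩ <;> rcases vinr l' with ⟨hfix', hv'⟩ | ⟨hne', hv'⟩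
    · rw [hv, hv'] at huu; exact congrArg Sum.inr (hb (Sum.inl.inj huu))
    · rw [hv, hv'] at huu
      obtain ⟨-, hm⟩ := (tinl _ _).mp huu.symm
      exact absurd rfl (hm l)
    · rw [hv, hv'] at huu
      obtain ⟨-, hm⟩ := (tinl _ _).mp huu
      exact absurd rfl (hm l')
    · rw [hv, hv'] at huu; exact congrArg Sum.inr (hb (σ.injective (tinj huu)))

omit [Fintype V] [DecidableEq V] hb ht1 ht2 hF1 hF4 hF5 in
/-- The complemented cover uses the new marked loop at `b l` iff the old cover did not use the old one. [this seat's lemma] -/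
theorem Fd_fix_iff (σ : Equiv.Perm V) (l : Fin 4) : Fd σ (Sum.inl (b l)) = Sum.inl (b l) ↔ σ (b l) ≠ b l := by
  constructor
  · intro h hfix
    rw [hF2 σ l hfix] at h; exact absurd h (by simp)
  · intro h; exact hF3 σ l h

variable {ok : V → V → Prop} {okC : V ⊕ Fin 4 → V ⊕ Fin 4 → Prop}
  (hO1 : ∀ i j, okC (Sum.inl i) (Sum.inl j) ↔ ((∀ l, b l ≠ i) ∧ (∀ l, b l ≠ j) ∧ ok i j) ∨ ((∃ l, b l = i) ∧ j = i))
  (hO2 : ∀ i k, okC (Sum.inl i) (Sum.inr k) ↔ ((∀ l, b l ≠ i) ∧ ok i (b k)) ∨ (i = b k ∧ ok (b k) (b k)))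
  (hO3 : ∀ l j, okC (Sum.inr l) (Sum.inl j) ↔ ((∀ k, b k ≠ j) ∧ ok (b l) j) ∨ j = b l)
  (hO4 : ∀ l k, okC (Sum.inr l) (Sum.inr k) ↔ (l ≠ k ∧ ok (b l) (b k)))
include hO1 hO2 hO3 hO4

omit [Fintype V] hb in
/-- **A present cover complements to a present cover.** [this seat's lemma] -/
theorem okC_Fd (σ : Equiv.Perm V) (hσ : ∀ i, ok i (σ i)) : ∀ u, okC u (Fd σ u) := by
  have tinl := t_eq_inl_iff ht1 ht2
  have tinr := t_eq_inr_iff ht1 ht2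
  intro u
  rcases u with i | l
  · by_cases hm : ∃ l, b l = i
    · obtain ⟨l, rfl⟩ := hm
      by_cases hfix : σ (b l) = b l
      · rw [hF2 σ l hfix, hO2]
        refine Or.inr ⟨rfl, ?_⟩
        have := hσ (b l); rwa [hfix] at this
      · rw [hF3 σ l hfix, hO1]; exact Or.inr ⟨⟨l, rfl⟩, rfl⟩
    · push Not at hm
      rw [hF1 σ i hm]
      rcases hv : t (σ i) with j | k
      · obtain ⟨hj, hmj⟩ := (tinl _ _).mp hv
        rw [hO1]; exact Or.inl ⟨hm, hmj, hj ▸ hσ i⟩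
      · have hk := (tinr _ _).mp hv
        rw [hO2]; exact Or.inl ⟨hm, hk ▸ hσ i⟩
  · by_cases hfix : σ (b l) = b l
    · rw [hF4 σ l hfix, hO3]; exact Or.inr rfl
    · rw [hF5 σ l hfix]
      rcases hv : t (σ (b l)) with j | k
      · obtain ⟨hj, hmj⟩ := (tinl _ _).mp hv
        rw [hO3]; exact Or.inl ⟨hmj, hj ▸ hσ (b l)⟩
      · have hk := (tinr _ _).mp hv
        rw [hO4]
        refine ⟨fun hlk => hfix ?_, hk ▸ hσ (b l)⟩
        rw [hk, hlk]

/-- **Every present cover of the enlarged node set is a complemented cover** (surjectivity of complementation onto present covers).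
[this seat's lemma; THEOREM-FOURBIT.md §5 «weight-preserving bijection of all covers»] -/
theorem exists_Fd_eq (τ : Equiv.Perm (V ⊕ Fin 4)) (hτ : ∀ u, okC u (τ u)) :
    ∃ σ : Equiv.Perm V, (∀ i, ok i (σ i)) ∧ ∀ u, Fd σ u = τ u := by
  have tinl := t_eq_inl_iff ht1 ht2
  have tinr := t_eq_inr_iff ht1 ht2
  have tinj := t_injective ht1 ht2
  -- reading the presence constraints on `τ`
  have A1 : ∀ i, (∀ k, b k ≠ i) → ∃ j, τ (Sum.inl i) = t j ∧ ok i j := by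
    intro i hm
    rcases hv : τ (Sum.inl i) with j | k
    · have h := (hO1 i j).mp (hv ▸ hτ (Sum.inl i))
      rcases h with ⟨-, hmj, hij⟩ | ⟨⟨l, hl⟩, -⟩
      · exact ⟨j, (ht2 j hmj).symm, hij⟩
      · exact absurd hl (hm l)
    · have h := (hO2 i k).mp (hv ▸ hτ (Sum.inl i))
      rcases h with ⟨-, hik⟩ | ⟨hik, -⟩
      · exact ⟨b k, (ht1 k).symm, hik⟩
      · exact absurd hik.symm (hm k)
  have A2 : ∀ l, (τ (Sum.inl (b l)) = Sum.inl (b l)) ∨ (τ (Sum.inl (b l)) = Sum.inr l ∧ ok (b l) (b l)) := by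
    intro l
    rcases hv : τ (Sum.inl (b l)) with j | k
    · have h := (hO1 (b l) j).mp (hv ▸ hτ (Sum.inl (b l)))
      rcases h with ⟨hm, -, -⟩ | ⟨-, hj⟩
      · exact absurd rfl (hm l)
      · exact Or.inl (by rw [hj])
    · have h := (hO2 (b l) k).mp (hv ▸ hτ (Sum.inl (b l)))
      rcases h with ⟨hm, -⟩ | ⟨hlk, hokk⟩
      · exact absurd rfl (hm l)
      · have := hb hlk; subst this; exact Or.inr ⟨rfl, hokk⟩
  have A3 : ∀ l, τ (Sum.inl (b l)) = Sum.inl (b l) → ∃ j, τ (Sum.inr l) = t j ∧ ok (b l) j ∧ j ≠ b l := by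
    intro l hloop
    rcases hv : τ (Sum.inr l) with j | k
    · have h := (hO3 l j).mp (hv ▸ hτ (Sum.inr l))
      rcases h with ⟨hmj, hokj⟩ | hj
      · exact ⟨j, (ht2 j hmj).symm, hokj, fun h => hmj l h.symm⟩
      · exfalso
        rw [hj, ← hloop] at hv
        exact absurd (τ.injective hv) (by simp)
    · have h := (hO4 l k).mp (hv ▸ hτ (Sum.inr l))
      exact ⟨b k, (ht1 k).symm, h.2, fun h' => h.1 (hb h').symm⟩
  have A4 : ∀ l, τ (Sum.inl (b l)) = Sum.inr l → τ (Sum.inr l) = Sum.inl (b l) := by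
    intro l hcyc
    obtain ⟨u, hu⟩ := τ.surjective (Sum.inl (b l))
    rcases u with i | l'
    · have h := (hO1 i (b l)).mp (hu ▸ hτ (Sum.inl i))
      rcases h with ⟨-, hm, -⟩ | ⟨-, hj⟩
      · exact absurd rfl (hm l)
      · rw [← hj, hcyc] at hu; exact absurd hu (by simp)
    · have h := (hO3 l' (b l)).mp (hu ▸ hτ (Sum.inr l'))
      rcases h with ⟨hm, -⟩ | hj
      · exact absurd rfl (hm l)
      · rw [hb hj] at hu ⊢; exact hu
  -- the old cover (choice functions first, then a case split on marked / unmarked)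
  classical
  obtain ⟨g1, hg1⟩ : ∃ g1 : V → V, ∀ i, (∀ k, b k ≠ i) → τ (Sum.inl i) = t (g1 i) ∧ ok i (g1 i) :=
    ⟨fun i => if h : (∀ k, b k ≠ i) then Classical.choose (A1 i h) else i,
      fun i h => by simp only [dif_pos h]; exact Classical.choose_spec (A1 i h)⟩
  obtain ⟨g3, hg3⟩ : ∃ g3 : Fin 4 → V, ∀ l, τ (Sum.inl (b l)) = Sum.inl (b l) →
      τ (Sum.inr l) = t (g3 l) ∧ ok (b l) (g3 l) ∧ g3 l ≠ b l :=
    ⟨fun l => if h : τ (Sum.inl (b l)) = Sum.inl (b l) then Classical.choose (A3 l h) else b l,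
      fun l h => by simp only [dif_pos h]; exact Classical.choose_spec (A3 l h)⟩
  let G : Fin 4 → V := fun l => if τ (Sum.inl (b l)) = Sum.inl (b l) then g3 l else b l
  let f : V → V := fun i => if hm : ∃ l, b l = i then G (Classical.choose hm) else g1 i
  -- its values
  have fU : ∀ i, (∀ k, b k ≠ i) → τ (Sum.inl i) = t (f i) ∧ ok i (f i) := by
    intro i hm
    have hm' : ¬ ∃ l, b l = i := fun ⟨l, hl⟩ => hm l hl
    simp only [f, dif_neg hm']
    exact hg1 i hm
  have fb : ∀ l, f (b l) = G l := by
    intro l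
    have hm : ∃ l', b l' = b l := ⟨l, rfl⟩
    have hl : Classical.choose hm = l := hb (Classical.choose_spec hm)
    show (if hm' : ∃ l', b l' = b l then G (Classical.choose hm') else g1 (b l)) = G l
    rw [dif_pos hm, hl]
  have fL : ∀ l, τ (Sum.inl (b l)) = Sum.inl (b l) → τ (Sum.inr l) = t (f (b l)) ∧ ok (b l) (f (b l)) ∧ f (b l) ≠ b l := by
    intro l hloop
    rw [fb l]
    simp only [G, if_pos hloop]
    exact hg3 l hloop
  have fC : ∀ l, τ (Sum.inl (b l)) = Sum.inr l → f (b l) = b l := by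
    intro l hcyc
    have hloop : ¬ τ (Sum.inl (b l)) = Sum.inl (b l) := by rw [hcyc]; simp
    rw [fb l]
    simp only [G, if_neg hloop]
  -- `t ∘ f = τ ∘ src` with an injective `src`
  have key : ∀ i, (t (f i) = τ (Sum.inl i) ∧ ((∀ k, b k ≠ i) ∨ ∃ l, b l = i ∧ τ (Sum.inl (b l)) = Sum.inr l)) ∨
      (∃ l, b l = i ∧ τ (Sum.inl (b l)) = Sum.inl (b l) ∧ t (f i) = τ (Sum.inr l)) := by
    intro i
    by_cases hm : ∃ l, b l = i
    · obtain ⟨l, rfl⟩ := hm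
      rcases A2 l with hloop | ⟨hcyc, -⟩
      · exact Or.inr ⟨l, rfl, hloop, (fL l hloop).1.symm⟩
      · left; refine ⟨?_, Or.inr ⟨l, rfl, hcyc⟩⟩
        rw [fC l hcyc, ht1, hcyc]
    · push Not at hm
      exact Or.inl ⟨(fU i hm).1.symm, Or.inl hm⟩
  have finj : Function.Injective f := by
    intro i i' h
    rcases key i with ⟨hv, hor⟩ | ⟨l, hl, hloop, hv⟩ <;> rcases key i' with ⟨hv', hor'⟩ | ⟨l', hl', hloop', hv'⟩
    · have := hv.symm.trans (h ▸ hv' : t (f i) = τ (Sum.inl i'))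
      exact Sum.inl.inj (τ.injective this)
    · have := hv.symm.trans (h ▸ hv' : t (f i) = τ (Sum.inr l'))
      exact absurd (τ.injective this) (by simp)
    · have := hv.symm.trans (h ▸ hv' : t (f i) = τ (Sum.inl i'))
      exact absurd (τ.injective this) (by simp)
    · have := hv.symm.trans (h ▸ hv' : t (f i) = τ (Sum.inr l'))
      have hll : l = l' := Sum.inr.inj (τ.injective this)
      rw [← hl, ← hl', hll]
  have fbij : Function.Bijective f := Finite.injective_iff_bijective.mp finj
  refine ⟨Equiv.ofBijective f fbij, fun i => ?_, fun u => ?_⟩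
  · change ok i (f i)
    by_cases hm : ∃ l, b l = i
    · obtain ⟨l, rfl⟩ := hm
      rcases A2 l with hloop | ⟨hcyc, hokk⟩
      · exact (fL l hloop).2.1
      · rw [fC l hcyc]; exact hokk
    · push Not at hm; exact (fU i hm).2
  · rcases u with i | l
    · by_cases hm : ∃ l, b l = i
      · obtain ⟨l, rfl⟩ := hm
        rcases A2 l with hloop | ⟨hcyc, -⟩
        · rw [hF3 _ l (fL l hloop).2.2, hloop]
        · rw [hF2 _ l (fC l hcyc), hcyc]
      · push Not at hm
        rw [hF1 _ i hm]; exact (fU i hm).1.symm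
    · rcases A2 l with hloop | ⟨hcyc, -⟩
      · rw [hF5 _ l (fL l hloop).2.2]; exact (fL l hloop).1.symm
      · rw [hF4 _ l (fC l hcyc)]; exact (A4 l hcyc).symm

end Redirect

end FourBit
end MarkedEdge
end Summit.ValiantsHypothesis.ValiantsHypothesis.Theorems.KPlusLogSqLaw
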